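import Summits.ValiantsHypothesis.ValiantsHypothesis.Theorems.KPlusLogSqLawTridiagonalRealStaticPumpHarvestNeg

/-!
# Route «KPlusLogSqLaw», crux `WeakLifting` (stmt-ValiantsHypothesis-19561) — REAL side of the tridiagonal sector:
# the pump iteration with the PARITY of its orientation (`ρ = (−1)^{k+1}`), for the even-size refinement `2m − 6`

HONEST FRAMING.  Helper (`--supports stmt-ValiantsHypothesis-19561 --as helper`), seat val-sym-lift-p1 (g12), cell `pub-symmetroid`,
2026-08-27.  `…PumpIter.pump_iter` hides the orientation `ρ` behind `ρ = 1 ∨ ρ = −1`; the harvest of `…PumpHarvestPos` (orientation `ρ = 1`)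
yields ONE MORE certified alternation than `…PumpHarvestNeg` (the transition zero at the junction).  To cash it in for the even sizes this file
re-runs the same induction recording `ρ = (−1)^{k+1}` (`pump_iter_parity`; proof verbatim up to the parity bookkeeping), and the companion
`…PumpEven` realises `B (2j+6) ≥ 4j + 6 = 2(2j+6) − 6`.  Nothing here is an upper bound; nothing bears on `WeakLifting` / `TropicalB` in their
windows, Conjecture B, the doors, `MatrixDescartes` (stmt-18050) or VP ≠ VNP.  [mechanism: val-sym-lift-p3 g9's pump; folklore analysis]
-/

-- `Summit.ValiantsHypothesis.ValiantsHypothesis.…` repeats a component by the D-0017 layout (single-conjunct summit); the name is mandated.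
set_option linter.dupNamespace false
set_option autoImplicit false

namespace Summit.ValiantsHypothesis.ValiantsHypothesis.Theorems.KPlusLogSqLaw.StaticTridiagonalRealLadder

open Polynomial
open Summit.ValiantsHypothesis.ValiantsHypothesis.Theorems.ValuativeFlip (ctK ctPath ctPath_apply ctK_zero ctK_one ctK_add_two)

/-- **AFTER `k` PUMP MOVES, WITH THE PARITY OF THE ORIENTATION** (`ρ = (−1)^{k+1}`; otherwise verbatim `pump_iter`): explicit-by-induction data `e, b, f` of a static definite tridiagonal `(k+4) × (k+4)`
monomial matrix, a reflection sign `ρ`, and sample data for which `(z ↦ D_{k+3}(ρz), z ↦ D_{k+4}(ρz))` satisfy the 17-clause pump invariant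
with `μ = −ρs`, positive actual sample points, and `|R| + |T| = 2k + 1`. [mechanism: val-sym-lift-p3 g9's pump; folklore analysis] -/
theorem pump_iter_parity (k : ℕ) :
    ∃ (e : ℕ → ℕ) (b : ℕ → ℝ) (f : ℕ → ℕ) (ρ s μ P0 x x₁ : ℝ) (R : List ℝ) (M : ℝ) (T : List ℝ) (y y₁ P1 : ℝ),
    ρ = (-1) ^ (k + 1) ∧ μ = -(ρ * s) ∧ 0 < ρ * P0 ∧ 0 < ρ * P1 ∧ R.length + T.length = 2 * k + 1 ∧
    ((P0 :: x :: x₁ :: (R ++ M :: (T ++ [y, y₁, P1]))).IsChain (· < ·) ∧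
    0 < s * (fun z : ℝ => (((ctPath (fun t => (X : ℝ[X]) ^ e t) (fun t => C (b t) * X ^ f t) (fun t => C (b (t - 1)) * X ^ f (t - 1)) (k + 4))).det).eval (ρ * z)) P0 ∧
    s * (fun z : ℝ => (((ctPath (fun t => (X : ℝ[X]) ^ e t) (fun t => C (b t) * X ^ f t) (fun t => C (b (t - 1)) * X ^ f (t - 1)) (k + 4))).det).eval (ρ * z)) x < 0 ∧
    s * (fun z : ℝ => (((ctPath (fun t => (X : ℝ[X]) ^ e t) (fun t => C (b t) * X ^ f t) (fun t => C (b (t - 1)) * X ^ f (t - 1)) (k + 4))).det).eval (ρ * z)) x₁ < 0 ∧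
    (∀ r ∈ R, s * (fun z : ℝ => (((ctPath (fun t => (X : ℝ[X]) ^ e t) (fun t => C (b t) * X ^ f t) (fun t => C (b (t - 1)) * X ^ f (t - 1)) (k + 4))).det).eval (ρ * z)) r < 0) ∧
    s * (fun z : ℝ => (((ctPath (fun t => (X : ℝ[X]) ^ e t) (fun t => C (b t) * X ^ f t) (fun t => C (b (t - 1)) * X ^ f (t - 1)) (k + 4))).det).eval (ρ * z)) M < 0 ∧
    (M :: (T ++ [y])).IsChain (fun u v => (fun z : ℝ => (((ctPath (fun t => (X : ℝ[X]) ^ e t) (fun t => C (b t) * X ^ f t) (fun t => C (b (t - 1)) * X ^ f (t - 1)) (k + 4))).det).eval (ρ * z)) u * (fun z : ℝ => (((ctPath (fun t => (X : ℝ[X]) ^ e t) (fun t => C (b t) * X ^ f t) (fun t => C (b (t - 1)) * X ^ f (t - 1)) (k + 4))).det).eval (ρ * z)) v < 0) ∧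
    μ * (fun z : ℝ => (((ctPath (fun t => (X : ℝ[X]) ^ e t) (fun t => C (b t) * X ^ f t) (fun t => C (b (t - 1)) * X ^ f (t - 1)) (k + 4))).det).eval (ρ * z)) y < 0 ∧
    s * (fun z : ℝ => (((ctPath (fun t => (X : ℝ[X]) ^ e t) (fun t => C (b t) * X ^ f t) (fun t => C (b (t - 1)) * X ^ f (t - 1)) (k + 3))).det).eval (ρ * z)) x₁ < 0 ∧
    (x₁ :: (R ++ [M])).IsChain (fun u v => (fun z : ℝ => (((ctPath (fun t => (X : ℝ[X]) ^ e t) (fun t => C (b t) * X ^ f t) (fun t => C (b (t - 1)) * X ^ f (t - 1)) (k + 3))).det).eval (ρ * z)) u * (fun z : ℝ => (((ctPath (fun t => (X : ℝ[X]) ^ e t) (fun t => C (b t) * X ^ f t) (fun t => C (b (t - 1)) * X ^ f (t - 1)) (k + 3))).det).eval (ρ * z)) v < 0) ∧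
    0 < μ * (fun z : ℝ => (((ctPath (fun t => (X : ℝ[X]) ^ e t) (fun t => C (b t) * X ^ f t) (fun t => C (b (t - 1)) * X ^ f (t - 1)) (k + 3))).det).eval (ρ * z)) M ∧
    (∀ t ∈ T, 0 < μ * (fun z : ℝ => (((ctPath (fun t => (X : ℝ[X]) ^ e t) (fun t => C (b t) * X ^ f t) (fun t => C (b (t - 1)) * X ^ f (t - 1)) (k + 3))).det).eval (ρ * z)) t) ∧
    0 < μ * (fun z : ℝ => (((ctPath (fun t => (X : ℝ[X]) ^ e t) (fun t => C (b t) * X ^ f t) (fun t => C (b (t - 1)) * X ^ f (t - 1)) (k + 3))).det).eval (ρ * z)) y ∧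
    0 < μ * (fun z : ℝ => (((ctPath (fun t => (X : ℝ[X]) ^ e t) (fun t => C (b t) * X ^ f t) (fun t => C (b (t - 1)) * X ^ f (t - 1)) (k + 3))).det).eval (ρ * z)) y₁ ∧
    μ * (fun z : ℝ => (((ctPath (fun t => (X : ℝ[X]) ^ e t) (fun t => C (b t) * X ^ f t) (fun t => C (b (t - 1)) * X ^ f (t - 1)) (k + 3))).det).eval (ρ * z)) P1 < 0 ∧
    (∀ z ∈ Set.Icc P0 x₁, s * (fun z : ℝ => (((ctPath (fun t => (X : ℝ[X]) ^ e t) (fun t => C (b t) * X ^ f t) (fun t => C (b (t - 1)) * X ^ f (t - 1)) (k + 3))).det).eval (ρ * z)) z < 0) ∧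
    (∀ z ∈ Set.Icc y P1, μ * (fun z : ℝ => (((ctPath (fun t => (X : ℝ[X]) ^ e t) (fun t => C (b t) * X ^ f t) (fun t => C (b (t - 1)) * X ^ f (t - 1)) (k + 4))).det).eval (ρ * z)) z < 0)) := by
  induction k with
  | zero =>
    exact ⟨(fun t : ℕ => if t = 2 then (1 : ℕ) else 0), (fun t : ℕ => if t = 0 then (1 : ℝ) else if t = 1 then 1 / 2 else 2), (fun t : ℕ => if t = 0 then (1 : ℕ) else if t = 1 then 0 else 2), -1, 1, 1, -(6 / 5), -(19 / 20), -(9 / 10), [], -(3 / 5),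
      [-(9 / 25)], -(29 / 100), -(7 / 25), -(1 / 5), by norm_num, by norm_num, by norm_num, by norm_num, by simp, pump_base₀⟩
  | succ k ih =>
    obtain ⟨e, b, f, ρ, s, μ, P0, x, x₁, R, M, T, y, y₁, P1, hρ, hμ, hρP0, hρP1, hlen,
      c1, c2a, c2b, c2c, c2d, c2e, c2f, c2g, c3c, c3d, c3e, c3f, c3g, c3h, c3i, c4, c5⟩ := ih
    -- orderings
    have o1 : P0 < x := (List.isChain_cons_cons.mp c1).1
    have o2 : x < x₁ := (List.isChain_cons_cons.mp (List.isChain_cons_cons.mp c1).2).1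
    have hP0P1 : P0 < P1 := lt_of_lt_of_le o1 (le_last_of_isChain c1 x (by simp))
    -- non-vanishing at the sample points
    have hG0 : (fun z : ℝ => (((ctPath (fun t => (X : ℝ[X]) ^ e t) (fun t => C (b t) * X ^ f t) (fun t => C (b (t - 1)) * X ^ f (t - 1)) (k + 4))).det).eval (ρ * z)) P0 ≠ 0 := by
      intro h0; rw [h0, mul_zero] at c2a; exact lt_irrefl _ c2a
    have hGx : (fun z : ℝ => (((ctPath (fun t => (X : ℝ[X]) ^ e t) (fun t => C (b t) * X ^ f t) (fun t => C (b (t - 1)) * X ^ f (t - 1)) (k + 4))).det).eval (ρ * z)) x ≠ 0 := by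
      intro h0; rw [h0, mul_zero] at c2b; exact lt_irrefl _ c2b
    have hF : ∀ P ∈ (x₁ :: (R ++ M :: (T ++ [y, y₁, P1]))), (fun z : ℝ => (((ctPath (fun t => (X : ℝ[X]) ^ e t) (fun t => C (b t) * X ^ f t) (fun t => C (b (t - 1)) * X ^ f (t - 1)) (k + 3))).det).eval (ρ * z)) P ≠ 0 := by
      intro P hP
      simp only [List.mem_cons, List.mem_append, List.mem_nil_iff, or_false] at hP
      rcases hP with rfl | hP | rfl | hP | rfl | rfl | rfl
      · intro h0; rw [h0, mul_zero] at c3c; exact lt_irrefl _ c3c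
      · exact ne_zero_of_isChain_alt₂ c3d (by simp) P (by simp [hP])
      · intro h0; rw [h0, mul_zero] at c3e; exact lt_irrefl _ c3e
      · intro h0; have := c3f P hP; rw [h0, mul_zero] at this; exact lt_irrefl _ this
      · intro h0; rw [h0, mul_zero] at c3g; exact lt_irrefl _ c3g
      · intro h0; rw [h0, mul_zero] at c3h; exact lt_irrefl _ c3h
      · intro h0; rw [h0, mul_zero] at c3i; exact lt_irrefl _ c3i
    have hFc := continuous_eval_det_epath e b f (k + 3) ρ
    have hGc := continuous_eval_det_epath e b f (k + 4) ρ
    rcases Nat.even_or_odd (k + 1) with hpar | hpar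
    · ------------------------------------------------------------------ type I move (ρ = 1, `k + 1` even)
      have hρ1 : ρ = 1 := by rw [hρ, Even.neg_one_pow hpar]
      subst hρ1
      have hP0 : 0 < P0 := by linarith
      obtain ⟨fe, κ, hκ, m1, m1', m2⟩ := pump_move_I (F := (fun z : ℝ => (((ctPath (fun t => (X : ℝ[X]) ^ e t) (fun t => C (b t) * X ^ f t) (fun t => C (b (t - 1)) * X ^ f (t - 1)) (k + 3))).det).eval (1 * z))) (G := (fun z : ℝ => (((ctPath (fun t => (X : ℝ[X]) ^ e t) (fun t => C (b t) * X ^ f t) (fun t => C (b (t - 1)) * X ^ f (t - 1)) (k + 4))).det).eval (1 * z)))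
        hP0 c1 hG0 hGx hF
      have hhc : Continuous (fun z : ℝ => (fun z : ℝ => (((ctPath (fun t => (X : ℝ[X]) ^ e t) (fun t => C (b t) * X ^ f t) (fun t => C (b (t - 1)) * X ^ f (t - 1)) (k + 4))).det).eval (1 * z)) z - κ * z ^ (2 * fe) * (fun z : ℝ => (((ctPath (fun t => (X : ℝ[X]) ^ e t) (fun t => C (b t) * X ^ f t) (fun t => C (b (t - 1)) * X ^ f (t - 1)) (k + 3))).det).eval (1 * z)) z) :=
        hGc.sub ((continuous_const.mul (continuous_id.pow _)).mul hFc)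
      obtain ⟨w₁, w, H⟩ := pump_step (f := (fun z : ℝ => (((ctPath (fun t => (X : ℝ[X]) ^ e t) (fun t => C (b t) * X ^ f t) (fun t => C (b (t - 1)) * X ^ f (t - 1)) (k + 3))).det).eval (1 * z))) (g := (fun z : ℝ => (((ctPath (fun t => (X : ℝ[X]) ^ e t) (fun t => C (b t) * X ^ f t) (fun t => C (b (t - 1)) * X ^ f (t - 1)) (k + 4))).det).eval (1 * z)))
        (h := fun z : ℝ => (fun z : ℝ => (((ctPath (fun t => (X : ℝ[X]) ^ e t) (fun t => C (b t) * X ^ f t) (fun t => C (b (t - 1)) * X ^ f (t - 1)) (k + 4))).det).eval (1 * z)) z - κ * z ^ (2 * fe) * (fun z : ℝ => (((ctPath (fun t => (X : ℝ[X]) ^ e t) (fun t => C (b t) * X ^ f t) (fun t => C (b (t - 1)) * X ^ f (t - 1)) (k + 3))).det).eval (1 * z)) z)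
        hGc hhc c1 c2a c2b c2c c2d c2e c2f c2g c3c c3d c3e c3f c3g c3h c3i c4 c5 m1 m1' m2
        (by
          intro z hz hz0
          have hzpos : 0 < z := hP0.trans_le hz.1
          refine ⟨1, κ * z ^ (2 * fe), one_pos, by positivity, ?_⟩
          have : (fun z : ℝ => (((ctPath (fun t => (X : ℝ[X]) ^ e t) (fun t => C (b t) * X ^ f t) (fun t => C (b (t - 1)) * X ^ f (t - 1)) (k + 4))).det).eval (1 * z)) z - κ * z ^ (2 * fe) * (fun z : ℝ => (((ctPath (fun t => (X : ℝ[X]) ^ e t) (fun t => C (b t) * X ^ f t) (fun t => C (b (t - 1)) * X ^ f (t - 1)) (k + 3))).det).eval (1 * z)) z = 0 := hz0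
          linarith)
      -- the extended data: vertex exponent 0, link (√κ, fe)
      obtain ⟨e', he'⟩ : ∃ e' : ℕ → ℕ, e' = fun t => if t < k + 4 then e t else 0 := ⟨_, rfl⟩
      obtain ⟨b', hb'⟩ : ∃ b' : ℕ → ℝ, b' = fun t => if t < k + 3 then b t else Real.sqrt κ := ⟨_, rfl⟩
      obtain ⟨f', hf'⟩ : ∃ f' : ℕ → ℕ, f' = fun t => if t < k + 3 then f t else fe := ⟨_, rfl⟩
      have hagree : ∀ n, n ≤ k + 4 → (ctPath (fun t => (X : ℝ[X]) ^ e' t) (fun t => C (b' t) * X ^ f' t) (fun t => C (b' (t - 1)) * X ^ f' (t - 1)) n) = (ctPath (fun t => (X : ℝ[X]) ^ e t) (fun t => C (b t) * X ^ f t) (fun t => C (b (t - 1)) * X ^ f (t - 1)) n) := by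
        intro n hn
        refine ctPath_congr_edata (fun t ht => ?_) (fun t ht => ?_) (fun t ht => ?_)
        · rw [he']; simp only [show t < k + 4 by omega, if_true]
        · rw [hb']; simp only [show t < k + 3 by omega, if_true]
        · rw [hf']; simp only [show t < k + 3 by omega, if_true]
      have hD3 : ∀ u : ℝ, (((ctPath (fun t => (X : ℝ[X]) ^ e' t) (fun t => C (b' t) * X ^ f' t) (fun t => C (b' (t - 1)) * X ^ f' (t - 1)) (k + 3))).det).eval u = (((ctPath (fun t => (X : ℝ[X]) ^ e t) (fun t => C (b t) * X ^ f t) (fun t => C (b (t - 1)) * X ^ f (t - 1)) (k + 3))).det).eval u := by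
        intro u; rw [hagree _ (by omega)]
      have hD4 : ∀ u : ℝ, (((ctPath (fun t => (X : ℝ[X]) ^ e' t) (fun t => C (b' t) * X ^ f' t) (fun t => C (b' (t - 1)) * X ^ f' (t - 1)) (k + 1 + 3))).det).eval u = (((ctPath (fun t => (X : ℝ[X]) ^ e t) (fun t => C (b t) * X ^ f t) (fun t => C (b (t - 1)) * X ^ f (t - 1)) (k + 4))).det).eval u := by
        intro u; rw [hagree _ (by omega)]
      have hD5 : ∀ u : ℝ, (((ctPath (fun t => (X : ℝ[X]) ^ e' t) (fun t => C (b' t) * X ^ f' t) (fun t => C (b' (t - 1)) * X ^ f' (t - 1)) (k + 1 + 4))).det).eval u =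
          (((ctPath (fun t => (X : ℝ[X]) ^ e t) (fun t => C (b t) * X ^ f t) (fun t => C (b (t - 1)) * X ^ f (t - 1)) (k + 4))).det).eval u - κ * u ^ (2 * fe) * (((ctPath (fun t => (X : ℝ[X]) ^ e t) (fun t => C (b t) * X ^ f t) (fun t => C (b (t - 1)) * X ^ f (t - 1)) (k + 3))).det).eval u := by
        intro u
        have h := eval_det_epath_add_two e' b' f' (k + 3) u
        have h1 : e' (k + 3 + 1) = 0 := by rw [he']; simp
        have h2 : b' (k + 3) ^ 2 = κ := by rw [hb']; simp only [lt_irrefl, if_false]; exact Real.sq_sqrt hκ.le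
        have h3 : f' (k + 3) = fe := by rw [hf']; simp
        have h4 : (((ctPath (fun t => (X : ℝ[X]) ^ e' t) (fun t => C (b' t) * X ^ f' t) (fun t => C (b' (t - 1)) * X ^ f' (t - 1)) (k + 3 + 1))).det).eval u = (((ctPath (fun t => (X : ℝ[X]) ^ e t) (fun t => C (b t) * X ^ f t) (fun t => C (b (t - 1)) * X ^ f (t - 1)) (k + 4))).det).eval u := by
          rw [hagree _ (by omega)]
        rw [h1, h2, h3, h4, hD3, pow_zero, one_mul] at h
        exact h
      refine ⟨e', b', f', -1, μ, -s, -P1, -y₁, -y, T.reverse.map (fun z : ℝ => -z), -M,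
        (x :: x₁ :: R).reverse.map (fun z : ℝ => -z), -w, -w₁, -P0, by rw [pow_succ, Even.neg_one_pow hpar]; norm_num,
        by rw [hμ]; ring, by linarith, by linarith,
        by simp; omega, ?_⟩
      simp only [hD4, hD5, one_mul, neg_mul, neg_neg, mul_neg] at H ⊢
      exact H
    · ------------------------------------------------------------------ type II move (ρ = −1, `k + 1` odd)
      have hρ1 : ρ = -1 := by rw [hρ, Odd.neg_one_pow hpar]
      subst hρ1
      have hP1 : P1 < 0 := by linarith
      obtain ⟨L, κ, hκ, m1, m1', m2⟩ := pump_move_II (F := (fun z : ℝ => (((ctPath (fun t => (X : ℝ[X]) ^ e t) (fun t => C (b t) * X ^ f t) (fun t => C (b (t - 1)) * X ^ f (t - 1)) (k + 3))).det).eval ((-1) * z))) (G := (fun z : ℝ => (((ctPath (fun t => (X : ℝ[X]) ^ e t) (fun t => C (b t) * X ^ f t) (fun t => C (b (t - 1)) * X ^ f (t - 1)) (k + 4))).det).eval ((-1) * z)))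
        hP1 c1 hG0 hGx hF
      have hhc : Continuous (fun z : ℝ => (-z) ^ L * (fun z : ℝ => (((ctPath (fun t => (X : ℝ[X]) ^ e t) (fun t => C (b t) * X ^ f t) (fun t => C (b (t - 1)) * X ^ f (t - 1)) (k + 4))).det).eval ((-1) * z)) z - κ * (fun z : ℝ => (((ctPath (fun t => (X : ℝ[X]) ^ e t) (fun t => C (b t) * X ^ f t) (fun t => C (b (t - 1)) * X ^ f (t - 1)) (k + 3))).det).eval ((-1) * z)) z) :=
        ((continuous_neg.pow L).mul hGc).sub (continuous_const.mul hFc)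
      obtain ⟨w₁, w, H⟩ := pump_step (f := (fun z : ℝ => (((ctPath (fun t => (X : ℝ[X]) ^ e t) (fun t => C (b t) * X ^ f t) (fun t => C (b (t - 1)) * X ^ f (t - 1)) (k + 3))).det).eval ((-1) * z))) (g := (fun z : ℝ => (((ctPath (fun t => (X : ℝ[X]) ^ e t) (fun t => C (b t) * X ^ f t) (fun t => C (b (t - 1)) * X ^ f (t - 1)) (k + 4))).det).eval ((-1) * z)))
        (h := fun z : ℝ => (-z) ^ L * (fun z : ℝ => (((ctPath (fun t => (X : ℝ[X]) ^ e t) (fun t => C (b t) * X ^ f t) (fun t => C (b (t - 1)) * X ^ f (t - 1)) (k + 4))).det).eval ((-1) * z)) z - κ * (fun z : ℝ => (((ctPath (fun t => (X : ℝ[X]) ^ e t) (fun t => C (b t) * X ^ f t) (fun t => C (b (t - 1)) * X ^ f (t - 1)) (k + 3))).det).eval ((-1) * z)) z)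
        hGc hhc c1 c2a c2b c2c c2d c2e c2f c2g c3c c3d c3e c3f c3g c3h c3i c4 c5 m1 m1' m2
        (by
          intro z hz hz0
          have hzneg : 0 < -z := by linarith [hz.2, o2, le_last_of_isChain c1 x₁ (by simp)]
          refine ⟨(-z) ^ L, κ, by positivity, hκ, ?_⟩
          have : (-z) ^ L * (fun z : ℝ => (((ctPath (fun t => (X : ℝ[X]) ^ e t) (fun t => C (b t) * X ^ f t) (fun t => C (b (t - 1)) * X ^ f (t - 1)) (k + 4))).det).eval ((-1) * z)) z - κ * (fun z : ℝ => (((ctPath (fun t => (X : ℝ[X]) ^ e t) (fun t => C (b t) * X ^ f t) (fun t => C (b (t - 1)) * X ^ f (t - 1)) (k + 3))).det).eval ((-1) * z)) z = 0 := hz0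
          linarith)
      -- the extended data: vertex exponent L, link (√κ, 0)
      obtain ⟨e', he'⟩ : ∃ e' : ℕ → ℕ, e' = fun t => if t < k + 4 then e t else L := ⟨_, rfl⟩
      obtain ⟨b', hb'⟩ : ∃ b' : ℕ → ℝ, b' = fun t => if t < k + 3 then b t else Real.sqrt κ := ⟨_, rfl⟩
      obtain ⟨f', hf'⟩ : ∃ f' : ℕ → ℕ, f' = fun t => if t < k + 3 then f t else 0 := ⟨_, rfl⟩
      have hagree : ∀ n, n ≤ k + 4 → (ctPath (fun t => (X : ℝ[X]) ^ e' t) (fun t => C (b' t) * X ^ f' t) (fun t => C (b' (t - 1)) * X ^ f' (t - 1)) n) = (ctPath (fun t => (X : ℝ[X]) ^ e t) (fun t => C (b t) * X ^ f t) (fun t => C (b (t - 1)) * X ^ f (t - 1)) n) := by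
        intro n hn
        refine ctPath_congr_edata (fun t ht => ?_) (fun t ht => ?_) (fun t ht => ?_)
        · rw [he']; simp only [show t < k + 4 by omega, if_true]
        · rw [hb']; simp only [show t < k + 3 by omega, if_true]
        · rw [hf']; simp only [show t < k + 3 by omega, if_true]
      have hD3 : ∀ u : ℝ, (((ctPath (fun t => (X : ℝ[X]) ^ e' t) (fun t => C (b' t) * X ^ f' t) (fun t => C (b' (t - 1)) * X ^ f' (t - 1)) (k + 3))).det).eval u = (((ctPath (fun t => (X : ℝ[X]) ^ e t) (fun t => C (b t) * X ^ f t) (fun t => C (b (t - 1)) * X ^ f (t - 1)) (k + 3))).det).eval u := by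
        intro u; rw [hagree _ (by omega)]
      have hD4 : ∀ u : ℝ, (((ctPath (fun t => (X : ℝ[X]) ^ e' t) (fun t => C (b' t) * X ^ f' t) (fun t => C (b' (t - 1)) * X ^ f' (t - 1)) (k + 1 + 3))).det).eval u = (((ctPath (fun t => (X : ℝ[X]) ^ e t) (fun t => C (b t) * X ^ f t) (fun t => C (b (t - 1)) * X ^ f (t - 1)) (k + 4))).det).eval u := by
        intro u; rw [hagree _ (by omega)]
      have hD5 : ∀ u : ℝ, (((ctPath (fun t => (X : ℝ[X]) ^ e' t) (fun t => C (b' t) * X ^ f' t) (fun t => C (b' (t - 1)) * X ^ f' (t - 1)) (k + 1 + 4))).det).eval u =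
          u ^ L * (((ctPath (fun t => (X : ℝ[X]) ^ e t) (fun t => C (b t) * X ^ f t) (fun t => C (b (t - 1)) * X ^ f (t - 1)) (k + 4))).det).eval u - κ * (((ctPath (fun t => (X : ℝ[X]) ^ e t) (fun t => C (b t) * X ^ f t) (fun t => C (b (t - 1)) * X ^ f (t - 1)) (k + 3))).det).eval u := by
        intro u
        have h := eval_det_epath_add_two e' b' f' (k + 3) u
        have h1 : e' (k + 3 + 1) = L := by rw [he']; simp
        have h2 : b' (k + 3) ^ 2 = κ := by rw [hb']; simp only [lt_irrefl, if_false]; exact Real.sq_sqrt hκ.le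
        have h3 : f' (k + 3) = 0 := by rw [hf']; simp
        have h4 : (((ctPath (fun t => (X : ℝ[X]) ^ e' t) (fun t => C (b' t) * X ^ f' t) (fun t => C (b' (t - 1)) * X ^ f' (t - 1)) (k + 3 + 1))).det).eval u = (((ctPath (fun t => (X : ℝ[X]) ^ e t) (fun t => C (b t) * X ^ f t) (fun t => C (b (t - 1)) * X ^ f (t - 1)) (k + 4))).det).eval u := by
          rw [hagree _ (by omega)]
        rw [h1, h2, h3, h4, hD3, mul_zero, pow_zero, mul_one] at h
        exact h
      refine ⟨e', b', f', 1, μ, -s, -P1, -y₁, -y, T.reverse.map (fun z : ℝ => -z), -M,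
        (x :: x₁ :: R).reverse.map (fun z : ℝ => -z), -w, -w₁, -P0, by rw [pow_succ, Odd.neg_one_pow hpar]; norm_num,
        by rw [hμ]; ring, by linarith, by linarith,
        by simp; omega, ?_⟩
      simp only [hD4, hD5, one_mul, neg_mul, neg_neg, mul_neg] at H ⊢
      exact H

end Summit.ValiantsHypothesis.ValiantsHypothesis.Theorems.KPlusLogSqLaw.StaticTridiagonalRealLadder
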